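import Summits.QuantumFields.YangMills.Theorems.BalabanUVNodesN12AtRecord13Prop1KnitThm1WindowDirectOfClassOnlyRowL1NearRadiusDatumScaleAtLengthOfRecordBTermPinnedChi

/-!
# BalabanUVNodes ∕ N12 — WINDOW-LOCAL EDITION of 174Chi ✓p803643 («167ᴾ» χ-generic): N12's TERM-PINNED LEAF CONSTRUCTOR AT PRINT's [II] (2.3) DATUM along the χ-generic
# history, with THE RUN's COUPLING WINDOW MOVED UNDER THE PER-RUN CONCLUSION — `… → ∀ P, λ.kSel P < P.K → Step.InInterval γβ P.K (gOfRecord₁₃Chi θL χ P) → B15Leaf (WOfRecord₁₃Chi θL χ λᴾ P)`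

Cell `pub-ymgap` (HUMAN RULING D-0062), seat `pub-ymgap-dag-n12-d` g37 (R134 N12 [B15] s2 «knit at the record»); helper of K1ᴬ `stmt-QuantumFields-27239` (DECIDING), `--kind proof
--supports … --as helper`, count-neutral.  Sibling of `BalabanUVNodesN12AtRecord13Prop1KnitThm1WindowDirectOfClassOnlyRowL1NearRadiusDatumScaleAtLengthOfRecordBTermPinnedChi` (dag-n12-d g36 ✓p803643; imported — every
`open`, every letter, the whole statement and the whole proof are that file's, byte-kept except the THREE declared edits below).

WHY (dag-lead g41 WORDS 645 (1) ∕ `K1AX-V11-LINE-TABLE.md` v1: «`stub_nodes13PWSVW` … -b dag-n12-d g37 (N12 pin at the bundle of record)»).  The registered K1ᴬ skeleton V11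
(✦ plan g100, `D100-K1V11/K1Skeleton13SepCoPHAxV11.lean` 54f620c18feea0f3; v11.1 1c0150ff21ca0f8d with this seat's σ-row `WOfRecord₁₃ ↦ WOfRecord₁₃Ax`) asks in rung 1ⱽᵂ
(`NodesAtSomeRecord13PWSVW`, LINE 2′ — staffed first) the [IV]-pin `(leavesP w P).rBasicStep ↔ B15Leaf (Node00.WOfRecord₁₃[Ax] F 2 θ.toStage13Params λ P)` on EVERY run with
`1 ≤ P.K` (`∀ P, 1 ≤ P.K → λ.kSel P < P.K`) but only INSIDE THE RUN's COUPLING WINDOW (`(leavesP w P).smallCouplings →`, i.e. `Step.InInterval w.γ P.K` of the run's flow).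
N12's junction chain (174Chi∕175Chi∕175Ax) carries the window as a GLOBAL row `tI : ∀ P, λ.kSel P < P.K → Step.InInterval γβ P.K (gOfRecord₁₃Chi θL χ P)` consumed run by run as
`(tI P hkP)` (174Chi :382); outside the window that row is false, so the junction as landed cannot be instantiated at `λ.kSel P := P.K − 1` for a world with runs off the
window.  THIS EDITION moves the window under the per-run conclusion — the shape rung 1ⱽᵂ consumes — with NO other change: (1) the binder `tI` is dropped; (2) the conclusion reads
`∀ P, lam.kSel P < P.K → Step.InInterval γβ P.K (gOfRecord₁₃Chi F 2 (Θ.liveRepin₁₃Chi F 2 χ) χ P) → B15Leaf (…)` (the leaf's text byte-identical); (3) the proof's last binder is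
`fun P hkP hIP` and 12P §1's window argument is `hIP` in place of `(tI P hkP)`.  Namespace `…WindowLocal…Chi`, theorem name `…_windowLocalOfClassOnlyRowL1NearRadiusDatumScale`.

HONEST FRAMING.  Kernel bookkeeping (a binder moved); the displayed rows of the parent stay DISPLAYED (NODE 00's `hres` ∕ live-mass rows, the term-pin data `σ sq Nm p₁ Dst` and 12P §1's
per-run rows, the β-sign box `BetaLowerH`, (2.8a) `tflow`, the four ℍ-leaves + (1.80) at the pinned letters, the (J0′) head's instance rows, the [15] Thm-1 letter `h15T` at length);
nothing of Bałaban's asserted; N12 NOT discharged; K0ᴬ ∕ K1ᴬ ∕ K3ᴬ OPEN; counts unmoved (discharged 8∕27 · K 1∕4); one finite 𝕋⁴ programme at fixed `ε = L^{-K}` — NOT continuum ∕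
ℝ⁴ ∕ OS; NOT the Yang–Mills mass gap (Clay).  THEOREMS ONLY (0 `def`, 0 `instance`, 0 `sorry`).
Sources (bookkeeping only): [Balaban1989LargeFieldI] (0.2)–(0.6) pp.176–177, (1.2) p.178 (the window `0 < g_k ≤ γ`), Prop. 1 (1.78) p.194, (1.80) p.195, (1.89) p.198, (1.99)–(1.102)
pp.200–201; [Balaban1988Convergent] (2.18) p.257, (3.22)–(3.25) pp.269–270; [Balaban1987RG1] Thm 1 p.259 (runs in the window), (0.17)–(0.20) pp.255–256, (2.9) p.266.
-/

noncomputable section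

open scoped BigOperators ENNReal
open MeasureTheory
open scoped Matrix.Norms.L2Operator
open MeasureTheory Set Finset Metric Filter
open scoped Matrix.Norms.L2Operator BigOperators Matrix RealInnerProductSpace Real InnerProductSpace Topology

namespace Summit.QuantumFields.YangMills.BalabanUVNodes.N12AtRecord13Prop1KnitThm1WindowLocalOfClassOnlyRowL1NearRadiusDatumScaleAtLengthOfRecordBTermPinnedChi

open Literature.MathematicalPhysics.QuantumFieldTheory.Balaban1983to89.B15DeterminingSetsB
open Literature.MathematicalPhysics.QuantumFieldTheory.Balaban1983to89
open Literature.MathematicalPhysics.QuantumFieldTheory.Balaban1983to89.T4Continuum (T4Family LStep Letter walk walkEnd netDisp holAt)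
open Literature.MathematicalPhysics.QuantumFieldTheory.Balaban1983to89.DagBinding
open Literature.MathematicalPhysics.QuantumFieldTheory.Balaban1983to89.Node00
open FlowStep (prefixOf BetaLowerH BetaUpperH)
open B15Claim189Assembly (Setting189 new189 chiPP dom half)
open B15 (Prop1Printed Ineq180)
open B15.BasicStep (Claim189)
open B15.PrelimIntegrations (Ineq191 Ineq195)
open B15Chi124DetSets (E124)
open B14DomainGeom (Pt)
open B8Eq17ClassAkV1 (plaqsOf)
open B14.Eq216Concrete (inputs feeds)
open GaugeGroup (dist1)
open GaugeField (plaqHol gaugeAct)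
open B15Claim189PrintedConditions (omegaOfChain)
open B15Claim189PinsOfHistory (N0OfRecord₁₃)
open B15Claim189LambdaPin (enlD)
open B15RPrime1100OfRep (rPrimeDataOfSel)
open T4CubeChartGnomonic (SU2)
open B15Prop1ChartSU2 (su2Chart)
open B15Prop1SliceCoordinates (GaugeSlice ιA)
open T4AxialGaugeSmallField (castSite boxPlaqs boxBonds)
open B6BondElimination (unitVec)
open B6TreeGaugePoincare (curl)
open B16Eq18Proof (box)
open B15Extension193 (extend)
open B15ShellGauge193 (shellGauge)
open B15Sect1Instances (fun177stdB)
open B14.Eq213DetSet (Bj maxDomT)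
open B14.Eq213MaximalDomains (side)
open B14.Eq22Determines (blockIter IsBlockUnion)
open Literature.MathematicalPhysics.QuantumFieldTheory.BalabanImbrieJaffe1984to88.BIJ85Eq453GaugeField (qsstarGIter0)
open B16Sect1Backgrounds (expMul toMS)
open B15DeterminingSets (pts DetBackground genSet IsMinimizer MSField avgFamily bondsOf DetSet embIter AgreeOn)
open B5Eq118OneStroke (iterBlockOf)
open Literature.MathematicalPhysics.QuantumFieldTheory.Balaban1983to89.Node00 (coeField constrEnumB)
open B15Eq112TorusCover (lift)
open ExpMeanLog (deltaSU)
open B15Prop1Carrier (lfVarOn InstOn InstOn.std InstOn.stdB plaqsInside)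
open Summit.QuantumFields.YangMills.BalabanUVNodes.N12Prop1DirectOfClassOnlyRowL1NearRadiusDatumScaleAtLengthWindowUniformB (exists_domain_prop1Printed_lfVarOn_std_su2_box_intrinsic_analytic_atZSeqCoPRecord_ofThm1AtLength_ofMinimiserFamily_ofClassOnlyRowL1NearRadiusDatumScale_ofWindowGaugeUniform_explicit)
open T4AdjointCovarianceUnitary (lieSU)
open B15Prop1GradientFromNearValueAtCoPRecord (far_letter_of_box)
open B15Prop1AnalyticExtClause (cplxVec anExt)
open B15Prop1ChartCalculusSU2 (E3)
open B15Sect1Instances (lamDatumP)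
open Summit.QuantumFields.YangMills.BalabanUVNodes.N12AtRecord13TermPinnedZresChi (b15Leaf_WOfRecord₁₃_pinAllΛΩχZ_N0_liveRepin₁₃_of_massLive_of_hasResiduals_of_flow_of_betaLowerH)
open B15Claim189PinsOfHistory (N0OfRecord₁₃Chi)

section
variable {F : T4Family}
variable (Θ : Stage13Params F 2) (χ : ChiSlot F 2) (lam : ResidW F 2)

/-- ★★★★ **WINDOW-LOCAL EDITION (the run's window `Step.InInterval γβ P.K (g P)` is an antecedent of the PER-RUN conclusion, not a global row) of the TERM-PINNED 12Q-OfRecordᴮ — N12's LEAF AT THE LIVE RE-PIN WITH ALL FOUR LETTERS OF `λ` OBJECTS OF RECORD**: for every tolerance family `δ` below the endpoint's explicit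
threshold and the per-run tolerance row `hfloor` (as in ✓p782535), `∃ areg > 0` such that, run by run below the torus, the [IV] leaf holds at the bundle of record
`WOfRecord₁₃ θL λᴾ P` of the FULLY PINNED layer `λᴾ := ((ResidW.pinRPrime₁₃Chi {λ with LF := lfVarOn su2Chart (InstOn.stdB (bgMSCoPOfRecordB …) ν.M₁ lamDatumP … areg …)} θL χ).pinD189ΛH
ν A₁ M g σᶻ sq Nm p₁)` (`θL := Θ.liveRepin₁₃`; `σᶻ` = 12P's `Z″`∕side∕`χ(Ω^{∼4})`∕`Ω″`-pinned situation family).  Prop. 1 per run by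
`exists_domain_prop1Printed_lfVarOn_std_su2_box_intrinsic_analytic_atZSeqCoPRecord_ofThm1AtLength_ofMinimiserFamily_ofClassOnlyRowL1NearRadiusDatumScale_ofWindowGaugeUniform_explicit`
(the parent's call, verbatim), the leaf by 12P §1 `b15Leaf_WOfRecord₁₃_pinAllΛΩχZ_N0_liveRepin₁₃_of_massLive_of_hasResiduals_of_flow_of_betaLowerH`.  Displayed: see the module docstring.
Count-neutral; CONDITIONAL; NOT a discharge of N12. [cite: Balaban1989LargeFieldI, (0.2)–(0.6) p.176, (1.2) p.178, (1.10)–(1.11) p.179, (1.73)–(1.74) p.192, Prop. 1 (1.77)–(1.78) p.194, (1.80) p.195, (1.89) p.198, (1.99)–(1.102) pp.200–201; Balaban1989LargeFieldII, (1.7)–(1.13) pp.358–359; Balaban1988Convergent, (2.1) p.254, (2.8) p.256, (2.12)–(2.14) pp.256–257, (2.17)–(2.18) p.257, (3.16) p.268, (3.22)–(3.25) pp.269–270; Balaban1987RG1, (0.20) p.256; Balaban1985Variational, Thm 1 (8) p.279, (44)–(47) p.285, (83) p.290, Prop. 9 (190) p.309; Balaban1984PropagatorsII, (2.3) p.224]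 -/
theorem exists_areg_pinLF_b15Leaf_WOfRecord₁₃_pinAllΛΩχZ_N0_liveRepin₁₃_of_massLive_of_hasResiduals_of_flow_of_betaLowerH_of_thm1AtLength_atZSeqCoPRecord_windowLocalOfClassOnlyRowL1NearRadiusDatumScale (hres : Θ.HasResidualsOfRecord F 2)
    -- N12's live-mass display at the step `kSel` of `λ`, run by run, BELOW THE TORUS (NODE 00)
    (hmassLive : ∀ P : B12.RunParams, lam.kSel P < P.K → ∀ s, LiveSeq F 2 Θ.ν Θ.τ9 P (gOfRecord₁₃Chi F 2 (Θ.liveRepin₁₃Chi F 2 χ) χ P) (lam.kSel P + 1)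
        (slotsTOfRecord F 2 Θ.ν Θ.τ9 (EOfRecord₁₃Chi F 2 (Θ.liveRepin₁₃Chi F 2 χ) χ) (wOfRecord₉ F 2 (Θ.liveRepin₁₃Chi F 2 χ).toStage9Params)
          (Θ.liveRepin₁₃Chi F 2 χ).ppSel P (gOfRecord₁₃Chi F 2 (Θ.liveRepin₁₃Chi F 2 χ) χ P) (lam.kSel P + 1)) s →
      0 < ∫ V, rterm (reprTOfRecord₁₃Chi F 2 (Θ.liveRepin₁₃Chi F 2 χ) χ P (lam.kSel P)) s V ∂(fieldMeasure (F.P P.K) (lam.kSel P + 1) (SU 2)))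
    -- THE TERM PINS (this file; dag-n12-e modules 14–19 ∕ this seat's 12P ✓p516715 §1): the (1.89) base situation family `σ`, the run's sequence of record `sq` at level `kSel P + 1`, the
    -- memory `Nm`, the cube exponent `p₁`; the numerics' signs the pinned stack reads
    (σ : ∀ P : B12.RunParams, Sit189 F 2 P.K)
    (sq : ∀ P : B12.RunParams, SeqOfRecord F Θ.ν Θ.τ9.M (gOfRecord₁₃Chi F 2 (Θ.liveRepin₁₃Chi F 2 χ) χ P) P.K (lam.kSel P + 1)) (Nm : B12.RunParams → ℕ) (p₁ : ℕ)
    (tM₂ : 0 < Θ.ν.M₂) (tMτ : 0 < Θ.τ9.M)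
    -- the PINNED (1.89) letters per run, named `Dst P` (an explicit family with its defining equation, so that the ℍ-leaf rows below read short): `Dst P = (λᴾ).D189 P` — STATED at
    -- `ResidW.pinRPrime₁₃Chi lam θL χ` (LF unpinned); this IS the LF-pinned layer's `D189 P` of the conclusion: the pins (`pinRPrime₁₃Chi_kSel` ∕ `pinD189ΛH_D189`, `rfl`) read `kSel` only, never `LF` (ref-J READ-707's NIT on the sibling, folded)
    (Dst : ∀ P : B12.RunParams, Setting189 (F.P P.K) (SU 2) (MSField (F.P P.K) (SU 2) × ((j : ℕ) → VecField (F.P P.K) j (EuclideanSpace ℝ (Fin (2 ^ 2 - 1))))) (Pt (F.P P.K).d))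
    (hDst : ∀ P : B12.RunParams, Dst P = ((ResidW.pinRPrime₁₃Chi lam (Θ.liveRepin₁₃Chi F 2 χ) χ).pinD189ΛH (Θ.liveRepin₁₃Chi F 2 χ).ν (Θ.liveRepin₁₃Chi F 2 χ).A₁ (Θ.liveRepin₁₃Chi F 2 χ).τ9.M (gOfRecord₁₃Chi F 2 (Θ.liveRepin₁₃Chi F 2 χ) χ) (fun P => (((((σ P).pinZres Θ.ν Θ.τ9.M (gOfRecord₁₃Chi F 2 (Θ.liveRepin₁₃Chi F 2 χ) χ P) (sq P) (N0OfRecord₁₃Chi (Θ.liveRepin₁₃Chi F 2 χ) χ P (lam.kSel P + 1))).pinSides Θ.ν (gOfRecord₁₃Chi F 2 (Θ.liveRepin₁₃Chi F 2 χ) χ P) (lam.kSel P + 1 - Nm P) (lam.kSel P + 1)).pinXΩ4 (sq P) (enlD F Θ.ν Θ.τ9.M P (gOfRecord₁₃Chi F 2 (Θ.liveRepin₁₃Chi F 2 χ) χ P))).pinOmegaPP (sq P) (Nm P) (enlD F Θ.ν Θ.τ9.M P (gOfRecord₁₃Chi F 2 (Θ.liveRepin₁₃Chi F 2 χ) χ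 P)))) sq Nm p₁).D189 P)
    -- 12P §1's rows, run by run below the torus: levels, the base situation's residual NUMBERS + print's two p.200 conditions, the small couplings along the memory, (2.8a) `tflow`,
    -- the β-sign box `tlow` (the run's window is NOT a row here: it guards the per-run conclusion), `Λ ≠ ∅`, then the four ℍ-leaves (1.91)ₕ∕(1.95)∕(1.91)∕(1.97) + (1.80) AT THE PINNED LETTERS `Dst P` ([15] Prop. 9 (190) ∕ N07 in-edges at objects)
    (tlog : ∀ P : B12.RunParams, lam.kSel P < P.K → 1 < (Real.log (gOfRecord₁₃Chi F 2 (Θ.liveRepin₁₃Chi F 2 χ) χ P (lam.kSel P + 1) ^ 2)⁻¹) ^ Θ.ν.r)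
    (tNN : ∀ P : B12.RunParams, lam.kSel P < P.K → N0OfRecord₁₃Chi (Θ.liveRepin₁₃Chi F 2 χ) χ P (lam.kSel P + 1) ≤ Nm P)
    (tNk : ∀ P : B12.RunParams, lam.kSel P < P.K → N0OfRecord₁₃Chi (Θ.liveRepin₁₃Chi F 2 χ) χ P (lam.kSel P + 1) ≤ lam.kSel P + 1)
    (tβ0 : ∀ P : B12.RunParams, lam.kSel P < P.K → 0 ≤ (σ P).β)
    (tβ : ∀ P : B12.RunParams, lam.kSel P < P.K → (σ P).β ≤ 1 / 4)
    (tL₀ : ∀ P : B12.RunParams, lam.kSel P < P.K → 2 ≤ (σ P).L₀)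
    (tL₀L : ∀ P : B12.RunParams, lam.kSel P < P.K → (σ P).L₀ ^ 2 ≤ ((F.P P.K).L : ℝ))
    (tB : ∀ P : B12.RunParams, lam.kSel P < P.K → 0 ≤ (σ P).O1 * (σ P).B₃ * (σ P).B₅)
    (tδ : ∀ P : B12.RunParams, lam.kSel P < P.K → 0 ≤ (σ P).δ)
    (tN₀ : ∀ P : B12.RunParams, lam.kSel P < P.K → (2 + (121 / 120) ^ 2 * ((σ P).O1 * (σ P).B₃ * (σ P).B₅ * (Θ.τ9.M : ℝ) ^ 5)) *
      ((((σ P).L₀ ^ 2) ^ (N0OfRecord₁₃Chi (Θ.liveRepin₁₃Chi F 2 χ) χ P (lam.kSel P + 1) - 1))⁻¹) ≤ 1 / 4)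
    (tMl : ∀ P : B12.RunParams, lam.kSel P < P.K → (121 / 120) ^ 2 * ((σ P).O1 * (σ P).B₃ * (σ P).B₅ * (Θ.τ9.M : ℝ) ^ 5) * Real.exp (-(4 * (σ P).δ * (Θ.τ9.M : ℝ))) ≤ 1 / 12)
    (tε0 : ∀ P : B12.RunParams, lam.kSel P < P.K → ∀ i, lam.kSel P + 1 - Nm P ≤ i → i ≤ lam.kSel P + 1 → 0 ≤ epsOfRecord Θ.ν (gOfRecord₁₃Chi F 2 (Θ.liveRepin₁₃Chi F 2 χ) χ P) i)
    (tε1 : ∀ P : B12.RunParams, lam.kSel P < P.K → ∀ i, lam.kSel P + 1 - Nm P ≤ i → i ≤ lam.kSel P + 1 → epsOfRecord Θ.ν (gOfRecord₁₃Chi F 2 (Θ.liveRepin₁₃Chi F 2 χ) χ P) i ≤ 1 / 10)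
    (β₀ : ℝ) (tβ₀0 : 0 ≤ β₀) (tβ₀ : β₀ ≤ 1 / 2)
    (tflow : ∀ P : B12.RunParams, lam.kSel P < P.K → ∀ j, lam.kSel P + 1 - Nm P ≤ j → j < lam.kSel P + 1 → epsOfRecord Θ.ν (gOfRecord₁₃Chi F 2 (Θ.liveRepin₁₃Chi F 2 χ) χ P) (lam.kSel P + 1)
      ≤ (1 + β₀) * Real.sqrt ((lam.kSel P + 1 - j : ℕ) : ℝ) * epsOfRecord Θ.ν (gOfRecord₁₃Chi F 2 (Θ.liveRepin₁₃Chi F 2 χ) χ P) j)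
    (bβ γβ : ℝ) (tb : 0 ≤ bβ) (tlow : BetaLowerH bβ γβ (betaOfRecord₁₃Chi F 2 (Θ.liveRepin₁₃Chi F 2 χ) χ)) (tγ1 : γβ ≤ 1)
    (tΛ : ∀ P : B12.RunParams, lam.kSel P < P.K → (((enlD F Θ.ν Θ.τ9.M P (gOfRecord₁₃Chi F 2 (Θ.liveRepin₁₃Chi F 2 χ) χ P)) 4 (lam.kSel P + 1 + 1 - (N0OfRecord₁₃Chi (Θ.liveRepin₁₃Chi F 2 χ) χ P (lam.kSel P + 1)))
        (omegaOfChain (sq P) (lam.kSel P + 1 + 1 - (N0OfRecord₁₃Chi (Θ.liveRepin₁₃Chi F 2 χ) χ P (lam.kSel P + 1)))))ᶜ ∩ (σ P).Z).Nonempty)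
    (L91h : ∀ P : B12.RunParams, lam.kSel P < P.K → ∀ U, new189 (Dst P) U → ∀ p ∈ plaqsOf (half (Dst P)),
      Ineq191 (dist1 (plaqHol ((Dst P).Upp U) p)) ((Dst P).devV'' U p) (Dst P).α (((Dst P).L ^ (Dst P).h)⁻¹) ((Dst P).ε (Dst P).h) (E124 (Dst P).ε (Dst P).L (Dst P).η (Dst P).k (Dst P).h))
    (L95 : ∀ P : B12.RunParams, lam.kSel P < P.K → ∀ U, new189 (Dst P) U → ∀ p ∈ plaqsOf (half (Dst P)),
      Ineq195 ((Dst P).devV'' U p) (dist1 (plaqHol ((Dst P).Uhalf U ((Dst P).boxOf p)) p)) (Dst P).α (((Dst P).L ^ (Dst P).h)⁻¹) ((Dst P).ε (Dst P).h) (E124 (Dst P).ε (Dst P).L (Dst P).η (Dst P).k (Dst P).h))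
    (L91 : ∀ P : B12.RunParams, lam.kSel P < P.K → ∀ U, new189 (Dst P) U → ∀ j, (Dst P).h ≤ j → j ≤ (Dst P).k → ∀ p ∈ plaqsOf (dom (Dst P) j),
      Ineq191 (dist1 (plaqHol ((Dst P).Upp U) p)) ((Dst P).dev97 U p) (Dst P).α (((Dst P).L ^ j)⁻¹) ((Dst P).ε j) (E124 (Dst P).ε (Dst P).L (Dst P).η (Dst P).k j))
    (L97 : ∀ P : B12.RunParams, lam.kSel P < P.K → ∀ U, new189 (Dst P) U → ∀ j, (Dst P).h ≤ j → j ≤ (Dst P).k → ∀ p ∈ plaqsOf (dom (Dst P) j),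
      Ineq191 ((Dst P).dev97 U p) ((Dst P).dev0 U p) (Dst P).α (((Dst P).L ^ j)⁻¹) ((Dst P).ε j) (E124 (Dst P).ε (Dst P).L (Dst P).η (Dst P).k j))
    (L80 : ∀ P : B12.RunParams, lam.kSel P < P.K → ∀ U, new189 (Dst P) U → ∀ j, (Dst P).h ≤ j → j ≤ (Dst P).k → ∀ p ∈ plaqsOf (dom (Dst P) j),
      Ineq180 ((Dst P).dev0 U p) ((Dst P).ε (Dst P).k) (Dst P).η (Dst P).B₃ (Dst P).B₅ (Dst P).M (Dst P).δ ((Dst P).dist p) (Dst P).O1)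
    -- dag-n12-w5's endpoint `N12Prop1DirectOfClassOnlyRowL1NearRadiusWindowUniform` ON THE RUN's LATTICE, per run `P` and instance family `ι P` (every letter of the endpoint displayed per run;
    -- `hfar` from the knit's box letter `hZ1` by `far_letter_of_box`; the [15] letter is the displayed at-length family `h15T` below, read per run)
    (hd3 : ∀ P : B12.RunParams, 3 ≤ (F.P P.K).d) (h0 : ∀ P : B12.RunParams, 0 < (F.P P.K).d) (ι : B12.RunParams → Type)
    {B₃ a₀ a₁' : ℝ}
    (Z Λ : ∀ P : B12.RunParams, ι P → Set (Site (F.P P.K) 0)) (k : ∀ P : B12.RunParams, ι P → ℕ) (M : ∀ P : B12.RunParams, ι P → ℝ) (hk0 : ∀ (P : B12.RunParams) (i : ι P), 0 < k P i) (hk1 : ∀ (P : B12.RunParams) (i : ι P), k P i + 1 ≤ (F.P P.K).m + (F.P P.K).K)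
    (eR : ∀ P : B12.RunParams, ι P → ℝ) (heR : ∀ (P : B12.RunParams) (i : ι P), 0 < eR P i)
    (T : ∀ (P : B12.RunParams) (i : ι P), Finset (PBond (F.P P.K) (k P i)))
    (lo hi : ∀ P : B12.RunParams, ι P → Fin (F.P P.K).d → ℤ) (n : ∀ P : B12.RunParams, ι P → ℕ) (hn : ∀ (P : B12.RunParams) (i : ι P) κ, hi P i κ ≤ lo P i κ + n P i) (hN : ∀ (P : B12.RunParams) (i : ι P), n P i + 2 < (F.P P.K).sitesPerDir (k P i))
    (hbox : ∀ (P : B12.RunParams) (i : ι P), pts (k P i) (Λ P i) = (castSite '' Set.Icc (lo P i) (hi P i) : Set (Site (F.P P.K) (k P i))))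
    (hZ : ∀ (P : B12.RunParams) (i : ι P), (boxPlaqs (lo P i - 1) (hi P i + 1) : Set (Plaq (F.P P.K) (k P i))) ⊆ plaqsInside (pts (k P i) (Z P i)))
    (hTG0 : ∀ (P : B12.RunParams) (i : ι P), T P i = (box (fun κ => (hi P i κ - lo P i κ + 1).toNat) (lo P i)).image fun x =>
      (⟨castSite (x - unitVec ⟨0, h0 P⟩), ⟨0, h0 P⟩⟩ : PBond (F.P P.K) (k P i)))
    (hN5 : ∀ (P : B12.RunParams) (i : ι P) κ, ((hi P i κ - lo P i κ + 1).toNat : ℤ) + 5 < (F.P P.K).sitesPerDir (k P i))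
    (Kb : ∀ P : B12.RunParams, ι P → ℕ) (hK1 : ∀ (P : B12.RunParams) (i : ι P), 1 ≤ Kb P i) (hKn : ∀ (P : B12.RunParams) (i : ι P) κ, (hi P i κ - lo P i κ + 1).toNat ≤ Kb P i)
    (ext : ∀ (P : B12.RunParams) (i : ι P), GaugeField (F.P P.K) (k P i) SU2 → GaugeField (F.P P.K) (k P i) SU2)
    (hext : ∀ (P : B12.RunParams) (i : ι P) Vk, ext P i Vk = extend (pts (k P i) (Λ P i)) (shellGauge Vk (lo P i) (hi P i)) Vk)
    (hlohi : ∀ (P : B12.RunParams) (i : ι P), lo P i ≤ hi P i)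
    -- the REGION parallelepipeds of the normalisation and the datum tolerances
    (LO HI : ∀ P : B12.RunParams, ι P → Fin (F.P P.K).d → ℤ) (hLO : ∀ (P : B12.RunParams) (i : ι P), LO P i ≤ lo P i - 1) (hHI : ∀ (P : B12.RunParams) (i : ι P), hi P i + 1 ≤ HI P i) (n' : ∀ P : B12.RunParams, ι P → ℕ) (hn' : ∀ (P : B12.RunParams) (i : ι P) κ, HI P i κ ≤ LO P i κ + n' P i)
    (hn'N : ∀ (P : B12.RunParams) (i : ι P), n' P i < (F.P P.K).sitesPerDir (k P i)) (hR' : ∀ (P : B12.RunParams) (i : ι P), (boxPlaqs (LO P i) (HI P i) : Set (Plaq (F.P P.K) (k P i))) ⊆ plaqsInside (pts (k P i) (Z P i)))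
    (ρn : ∀ P : B12.RunParams, ι P → ℝ)
    (hρn : ∀ (P : B12.RunParams) (i : ι P), (((F.P P.K).d : ℝ) * n' P i + 1) * ((((F.P P.K).d - 1 : ℕ) : ℝ) * n' P i * ((12 * (F.P P.K).d * (n P i + 2) ^ 2 + 1) * eR P i)
      + 3 * (F.P P.K).d * (n P i + 2) ^ 2 * eR P i) ≤ ρn P i)
    {γ₈ cJ bx : B12.RunParams → ℝ} (hγ : ∀ P : B12.RunParams, 0 < γ₈ P) (hcJ : ∀ P : B12.RunParams, 0 ≤ cJ P) (hbx : ∀ P : B12.RunParams, 0 ≤ bx P)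
    (hbxM : ∀ (P : B12.RunParams) (i : ι P), 12 * ((F.P P.K).d : ℝ) * ((n P i : ℝ) + 2) ^ 2 ≤ bx P * (M P i) ^ 2)
    {R 𝓐₀ : ∀ P : B12.RunParams, ι P → ℝ} (hM : ∀ (P : B12.RunParams) (i : ι P), 1 ≤ (M P i)) (hR : ∀ (P : B12.RunParams) (i : ι P), 0 < R P i) (h𝓐₀ : ∀ (P : B12.RunParams) (i : ι P), 0 ≤ 𝓐₀ P i)
    -- (J0′), R-EXPLICIT: per instance one radius and one bound for every base field of the strict guard
    (hMin : ∀ (P : B12.RunParams) (i : ι P) Vk, PlaqSmallOn (plaqsInside (pts (k P i) (Z P i ∩ (Λ P i)ᶜ))) (eR P i) Vk →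
      ∃ Ũ : VecField (F.P P.K) (k P i) (EuclideanSpace ℂ (Fin 3)) × VecField (F.P P.K) (k P i) (EuclideanSpace ℂ (Fin 3)) →
          PBond (F.P P.K) 0 → Matrix (Fin 2) (Fin 2) ℂ,
        (∀ b a c, DifferentiableOn ℂ (fun z => Ũ z b a c) (ball 0 (R P i))) ∧
        (∀ z ∈ ball (0 : VecField (F.P P.K) (k P i) (EuclideanSpace ℂ (Fin 3)) × VecField (F.P P.K) (k P i) (EuclideanSpace ℂ (Fin 3))) (R P i),
          ∀ b a c, ‖Ũ z b a c‖ ≤ 𝓐₀ P i) ∧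
        ∀ p B' : VecField (F.P P.K) (k P i) E3, ‖p‖ < R P i → ‖B'‖ < R P i → ∃ U' : GaugeField (F.P P.K) 0 SU2,
          (∀ b, Ũ (cplxVec p, cplxVec B') b = ((U' b : SU2) : Matrix (Fin 2) (Fin 2) ℂ)) ∧
            IsMinimizerB (Node00.avOfRecord F 2 P.K) (Node00.regMSCoPOfRecord F 2 Θ.ν P.K (k P i) (maxDomT Θ.ν.M₁ (Z P i))) (lamBondsSeq (maxDomT Θ.ν.M₁ (Z P i)) (k P i))
              (avgFamily (Node00.avOfRecord F 2 P.K) (qsstarGIter0 (k P i) (expMul su2Chart B' (ext P i (expMul su2Chart p Vk))))) U')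
    -- dag-n12-w4's GEOMETRY letter of the chart file (the window box and its two shifts inside `Ω_k(Z)`)
    (hΩw : ∀ (P : B12.RunParams) (i : ι P), ∀ (ν' : Fin (F.P P.K).d), ∀ z ∈ box (fun κ => (hi P i κ - lo P i κ + 1).toNat + 3) (fun κ => lo P i κ - 2),
      (castSite z : Site (F.P P.K) (k P i)) ∈ pts (k P i) (maxDomT Θ.ν.M₁ (Z P i) (k P i)) ∧
        (castSite z : Site (F.P P.K) (k P i)).shift ⟨0, h0 P⟩ ∈ pts (k P i) (maxDomT Θ.ν.M₁ (Z P i) (k P i)) ∧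
        (castSite z : Site (F.P P.K) (k P i)).shift ν' ∈ pts (k P i) (maxDomT Θ.ν.M₁ (Z P i) (k P i)))
    -- the WINDOW per instance, containing every plaquette whose source lies in the fine image of the enlarged window box (the chart half's `hW`)
    (W : ∀ P : B12.RunParams, ι P → Finset (Plaq (F.P P.K) 0))
    (hWbox : ∀ (P : B12.RunParams) (i : ι P), ∀ q : Plaq (F.P P.K) 0, q.src ∈ ((box (fun κ => (F.P P.K).L ^ (k P i) * ((hi P i κ - lo P i κ + 1).toNat + 3 + 1) - 1) (fun κ => ((F.P P.K).L : ℤ) ^ (k P i) * (lo P i κ - 2))).image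
        (fun z => (castSite z : Site (F.P P.K) 0))) → q ∈ W P i)
    -- dag-n12-w6 g7's k-UNIFORM WINDOW-LOCAL (σ)_W producer `N12WindowGaugeLetterUniformSocketLam.hσW_on_uniform_of_class_lamBondsSeq` (general `Z`, no letter off the window, tolerance `C(d,L)·εreg + m′·ρn`
    -- INDEPENDENT of `k`): its NUMERICS per instance (level guard `k + c ≤ m + K` with `4d + m′ + 3 < 2L^c`), the class threshold `εreg` positive and Prop. 2-small, the WINDOW `X i` within
    -- walk-distance `D₀ i` of `Ω_{k_i}(Z_i)` (`hXΩ`) with the collar fit `hfit`, the REGION-BOX ROW `hBox` and the two window rows `hWX hfeedsX`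
    (c : ∀ P : B12.RunParams, ι P → ℕ) (hkc : ∀ (P : B12.RunParams) (i : ι P), k P i + c P i ≤ (F.P P.K).m + (F.P P.K).K) (hc : ∀ (P : B12.RunParams) (i : ι P), 4 * (F.P P.K).d + (3 * ((F.P P.K).d * (((F.P P.K).L - 1) / 2)) + 5) + 3 < 2 * (F.P P.K).L ^ c P i)
    (hα3 : ∀ P : B12.RunParams, (143 * (((((F.P P.K).d + 4 : ℕ) : ℝ)) ^ 2 / 4) ^ 2) * (Θ.ν.εreg * (F.P P.K).L ^ 2) ≤ 1 / 3)
    (hα2 : ∀ P : B12.RunParams, 2 * (Θ.ν.εreg * (F.P P.K).L ^ 2) ≤ 2 * deltaSU (Fin 2) / ((((F.P P.K).d + 4) * (F.P P.K).L : ℕ) : ℝ) ^ 2)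
    (haN : ∀ P : B12.RunParams, (((((F.P P.K).d + 2) * (F.P P.K).L : ℕ) : ℝ) ^ 2 / 4) * (2 * (Θ.ν.εreg * (F.P P.K).L ^ 2)) < deltaSU (Fin 2))
    (X : ∀ P : B12.RunParams, ι P → Set (Site (F.P P.K) 0)) (D₀ : ∀ P : B12.RunParams, ι P → ℕ)
    (hXΩ : ∀ (P : B12.RunParams) (i : ι P), ∀ x ∈ X P i, ∃ x₀ ∈ maxDomT Θ.ν.M₁ (Z P i) (k P i), ∃ w₀ : List (Letter (F.P P.K).d), w₀.length ≤ D₀ P i ∧ walkEnd x₀ w₀ = x)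
    (hfit : ∀ (P : B12.RunParams) (i : ι P), D₀ P i + 3 * (∑ i' ∈ Finset.range (k P i + 1), ((F.P P.K).d * (((F.P P.K).L ^ i' - 1) / 2) + 1)) + ((3 * ((F.P P.K).d * (((F.P P.K).L - 1) / 2)) + 5) + 5) * (F.P P.K).L ^ k P i +
      (((F.P P.K).d + 4) * (F.P P.K).L + 2) * (∑ l ∈ Finset.Ico 0 (k P i), (F.P P.K).L ^ l) + 4 ≤ (F.P P.K).L ^ (k P i - 1) * Θ.ν.M₁)
    (hBox : ∀ (P : B12.RunParams) (i : ι P), ∀ x ∈ X P i, ∀ w : List (Letter (F.P P.K).d),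
      w.length ≤ (∑ i' ∈ Finset.range (k P i + 1), ((F.P P.K).d * (((F.P P.K).L ^ i' - 1) / 2) + 1)) + (3 * ((F.P P.K).d * (((F.P P.K).L - 1) / 2)) + 5) * (F.P P.K).L ^ k P i + (F.P P.K).L ^ k P i →
      ∀ μ : Fin (F.P P.K).d, (⟨B14.Eq22Determines.blockIter (k P i) (walkEnd x w), μ⟩ : PBond (F.P P.K) (k P i)) ∈ (boxBonds (LO P i) (HI P i) : Set (PBond (F.P P.K) (k P i))))
    (hWX : ∀ (P : B12.RunParams) (i : ι P), ∀ p ∈ W P i, p.src ∈ X P i ∧ p.src.shift p.μ ∈ X P i ∧ p.src.shift p.ν ∈ X P i ∧ (p.src.shift p.μ).shift p.ν ∈ X P i ∧ (p.src.shift p.ν).shift p.μ ∈ X P i)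
    (hfeedsX : ∀ (P : B12.RunParams) (i : ι P) (ν' : Fin (F.P P.K).d), ∀ z ∈ box (fun κ => (hi P i κ - lo P i κ + 1).toNat + 3) (fun κ => lo P i κ - 2), ∀ b₀ : PBond (F.P P.K) 0,
      (b₀ ∈ feeds (k P i) (⟨(castSite z : Site (F.P P.K) (k P i)), ⟨0, h0 P⟩⟩ : PBond (F.P P.K) (k P i)) ∨
        b₀ ∈ feeds (k P i) (⟨((castSite z : Site (F.P P.K) (k P i))).shift ⟨0, h0 P⟩, ν'⟩ : PBond (F.P P.K) (k P i)) ∨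
        b₀ ∈ feeds (k P i) (⟨((castSite z : Site (F.P P.K) (k P i))).shift ν', ⟨0, h0 P⟩⟩ : PBond (F.P P.K) (k P i)) ∨
        b₀ ∈ feeds (k P i) (⟨(castSite z : Site (F.P P.K) (k P i)), ν'⟩ : PBond (F.P P.K) (k P i))) → b₀.src ∈ X P i ∧ b₀.tgt ∈ X P i)
    -- THE CHART HALF, DISPLAYED, `hsb`-FREE AND IN PER-ROW ℓ¹ CURRENCY (LOCATED-FLOOR + LOCATED-HSB + census U2b): FIVE per-height constants as BINDERS and ONE letter = the ∀-body of
    -- dag-n12-c g22's ρ6b `N12DirectChartPackageOfClassRowL1FamilyB.exists_hWD_chartHalf_of_class_uniform_rowl1_family` at height `k i` (the right inverse `H` witnesses surjectivity only;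
    -- its size enters through the PER-ROW ℓ¹ PREIMAGE LETTER at `B₁`, the curvature through the ℓ¹-curvature letter at `M₂`; (μ) constant `2(d−1)·εP·B₁·M₂` — NO torus bond count)
    (C ρ Kτ ρτ ρ5 : ∀ P : B12.RunParams, ι P → ℝ) (hρ : ∀ (P : B12.RunParams) (i : ι P), 0 < ρ P i) (hKτ : ∀ (P : B12.RunParams) (i : ι P), 0 ≤ Kτ P i) (hρτ : ∀ (P : B12.RunParams) (i : ι P), 0 < ρτ P i)
    (hhalf : ∀ (P : B12.RunParams) (i : ι P),
        ∀ (νu : Node00.Stage7Numerics) (Z Λ : Set (Site (F.P P.K) 0)) (T : Finset (PBond (F.P P.K) (k P i))) (lo hi : Fin (F.P P.K).d → ℤ),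
        (∀ κ, ((((hi κ - lo κ + 1).toNat + 3 : ℕ) : ℤ)) ≤ (F.P P.K).sitesPerDir (k P i)) →
        (∀ (ν' : Fin (F.P P.K).d), ∀ z ∈ box (fun κ => (hi κ - lo κ + 1).toNat + 3) (fun κ => lo κ - 2),
          (castSite z : Site (F.P P.K) (k P i)) ∈ pts (k P i) (maxDomT νu.M₁ Z (k P i)) ∧ (castSite z : Site (F.P P.K) (k P i)).shift ⟨0, h0 P⟩ ∈ pts (k P i) (maxDomT νu.M₁ Z (k P i)) ∧
            (castSite z : Site (F.P P.K) (k P i)).shift ν' ∈ pts (k P i) (maxDomT νu.M₁ Z (k P i))) →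
        (k P i) + 1 ≤ (F.P P.K).m + (F.P P.K).K → 4 * (F.P P.K).L ≤ νu.M₁ → side (F.P P.K).L νu.M₁ (k P i) ∣ (F.P P.K).sitesPerDir 0 → 0 ≤ νu.εreg →
        6 * ((((F.P P.K).d - 1 : ℕ)) : ℝ) * (F.P P.K).L * νu.εreg ≤ ρ5 P i →
        ∀ (ext : GaugeField (F.P P.K) (k P i) SU2 → GaugeField (F.P P.K) (k P i) SU2) (Vk : GaugeField (F.P P.K) (k P i) SU2),
        ∀ (U₀ : GaugeField (F.P P.K) 0 SU2) (Xf : GaugeSlice (pts (k P i) Λ) T E3 → PBond (F.P P.K) 0 → lieSU (Fin 2)),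
        IsMinimizerB (Node00.avOfRecord F 2 P.K) (Node00.regMSCoPOfRecord F 2 νu P.K (k P i) (maxDomT νu.M₁ Z)) (lamBondsSeq (maxDomT νu.M₁ Z) (k P i))
          (avgFamily (Node00.avOfRecord F 2 P.K) (qsstarGIter0 (k P i) (ext Vk))) U₀ →
        ∀ (S₀ : Set (PBond (F.P P.K) 0)), (∀ b ∉ S₀, b ∈ lamBondsSeq (maxDomT νu.M₁ Z) (k P i) 0) → ∀ ⦃εP : ℝ⦄, 0 ≤ εP →
        (∀ p : Plaq (F.P P.K) 0, ((⟨p.src, p.μ⟩ : PBond (F.P P.K) 0) ∈ S₀ ∨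
            (⟨p.src.shift p.μ, p.ν⟩ : PBond (F.P P.K) 0) ∈ S₀ ∨
            (⟨p.src.shift p.ν, p.μ⟩ : PBond (F.P P.K) 0) ∈ S₀ ∨
            (⟨p.src, p.ν⟩ : PBond (F.P P.K) 0) ∈ S₀) →
          ‖((GaugeField.plaqHol U₀ p : SU2) : Matrix (Fin 2) (Fin 2) ℂ) - 1‖ ≤ εP) →
        ∀ (H : (Fin (constrCardB (lamBondsSeq (maxDomT νu.M₁ Z) (k P i)) (k P i)) → lieSU (Fin 2)) → PBond (F.P P.K) 0 → lieSU (Fin 2)),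
        (∀ v, fderiv ℝ (msChartB F 2 P.K (k P i) (lamBondsSeq (maxDomT νu.M₁ Z) (k P i)) (avgFamily (avOfRecord F 2 P.K) (qsstarGIter0 (k P i) (ext Vk))) U₀) 0 (H v) = v) →
        ∀ ⦃B₁ : ℝ⦄, 0 ≤ B₁ →
        (∀ i' : Fin (constrCardB (lamBondsSeq (maxDomT νu.M₁ Z) (k P i)) (k P i)), 1 ≤ ((((constrEnumB (lamBondsSeq (maxDomT νu.M₁ Z) (k P i)) (k P i)).symm i').1 : ℕ)) → ∀ ξ : lieSU (Fin 2),
          ∃ x : PBond (F.P P.K) 0 → lieSU (Fin 2), fderiv ℝ (msChartB F 2 P.K (k P i) (lamBondsSeq (maxDomT νu.M₁ Z) (k P i)) (avgFamily (avOfRecord F 2 P.K) (qsstarGIter0 (k P i) (ext Vk))) U₀) 0 x = Pi.single i' ξ ∧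
            ∑ b, ‖(x b : Matrix (Fin 2) (Fin 2) ℂ)‖ ≤ B₁ * ‖ξ‖) →
        ∀ ⦃M₂ : ℝ⦄, (∀ w, ∑ c, ‖fderiv ℝ (fderiv ℝ (msChartB F 2 P.K (k P i) (lamBondsSeq (maxDomT νu.M₁ Z) (k P i)) (avgFamily (avOfRecord F 2 P.K) (qsstarGIter0 (k P i) (ext Vk))) U₀)) 0 w w c‖ ≤ M₂ * ∑ b, ‖w b‖ ^ 2) →
        Xf 0 = 0 → ContDiffAt ℝ 2 Xf 0 →
        (∀ᶠ Y in 𝓝 (0 : GaugeSlice (pts (k P i) Λ) T E3),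
          IsMinimizerB (Node00.avOfRecord F 2 P.K) (Node00.regMSCoPOfRecord F 2 νu P.K (k P i) (maxDomT νu.M₁ Z)) (lamBondsSeq (maxDomT νu.M₁ Z) (k P i))
            (avgFamily (Node00.avOfRecord F 2 P.K) (qsstarGIter0 (k P i) (expMul su2Chart (ιA (pts (k P i) Λ) T Y) (ext Vk)))) (expChart U₀ (Xf Y))) →
        ∀ ⦃K₂ : ℝ⦄, (∀ X : GaugeSlice (pts (k P i) Λ) T E3, Real.sqrt (∑ b, ‖fderiv ℝ Xf 0 X b‖ ^ 2) ≤ K₂ * ‖X‖) →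
        ∀ (W : Finset (Plaq (F.P P.K) 0)),
        (∀ q : Plaq (F.P P.K) 0, q.src ∈ ((box (fun κ => (F.P P.K).L ^ (k P i) * ((hi κ - lo κ + 1).toNat + 3 + 1) - 1) (fun κ => ((F.P P.K).L : ℤ) ^ (k P i) * (lo κ - 2))).image
            (fun z => (castSite z : Site (F.P P.K) 0))) → q ∈ W) →
        ∀ ⦃δW : ℝ⦄, 0 < δW → δW < ρ P i → δW < ρτ P i →
        (∀ (ν' : Fin (F.P P.K).d), ∀ z ∈ box (fun κ => (hi κ - lo κ + 1).toNat + 3) (fun κ => lo κ - 2), ∀ b₀ : PBond (F.P P.K) 0,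
          (b₀ ∈ feeds (k P i) (⟨(castSite z : Site (F.P P.K) (k P i)), ⟨0, h0 P⟩⟩ : PBond (F.P P.K) (k P i)) ∨ b₀ ∈ feeds (k P i) (⟨((castSite z : Site (F.P P.K) (k P i))).shift ⟨0, h0 P⟩, ν'⟩ : PBond (F.P P.K) (k P i))
          ∨ b₀ ∈ feeds (k P i) (⟨((castSite z : Site (F.P P.K) (k P i))).shift ν', ⟨0, h0 P⟩⟩ : PBond (F.P P.K) (k P i)) ∨ b₀ ∈ feeds (k P i) (⟨(castSite z : Site (F.P P.K) (k P i)), ν'⟩ : PBond (F.P P.K) (k P i))) →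
          ‖((U₀ b₀ : SU2) : Matrix (Fin 2) (Fin 2) ℂ) - 1‖ ≤ δW) →
        ∃ (Ψ₂ : (PBond (F.P P.K) 0 → lieSU (Fin 2)) →L[ℝ] (PBond (F.P P.K) 0 → lieSU (Fin 2)) →L[ℝ] (Fin (constrCardB (lamBondsSeq (maxDomT νu.M₁ Z) (k P i)) (k P i)) → lieSU (Fin 2)))
          (lam : (Fin (constrCardB (lamBondsSeq (maxDomT νu.M₁ Z) (k P i)) (k P i)) → lieSU (Fin 2)) →L[ℝ] ℝ)
          (p : Seminorm ℝ (PBond (F.P P.K) 0 → lieSU (Fin 2))),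
          HasFDerivAt (fun Y => fderiv ℝ (msChartB F 2 P.K (k P i) (lamBondsSeq (maxDomT νu.M₁ Z) (k P i)) (avgFamily (avOfRecord F 2 P.K) (qsstarGIter0 (k P i) (ext Vk))) U₀) Y) Ψ₂ 0 ∧
          (∀ᶠ Y in 𝓝 (0 : PBond (F.P P.K) 0 → lieSU (Fin 2)), DifferentiableAt ℝ (msChartB F 2 P.K (k P i) (lamBondsSeq (maxDomT νu.M₁ Z) (k P i)) (avgFamily (avOfRecord F 2 P.K) (qsstarGIter0 (k P i) (ext Vk))) U₀) Y) ∧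
          fderiv ℝ (fun Y : PBond (F.P P.K) 0 → lieSU (Fin 2) => wilsonAction4 (expChart U₀ Y)) 0 = lam.comp (fderiv ℝ (msChartB F 2 P.K (k P i) (lamBondsSeq (maxDomT νu.M₁ Z) (k P i)) (avgFamily (avOfRecord F 2 P.K) (qsstarGIter0 (k P i) (ext Vk))) U₀) 0) ∧
          (∀ Y : PBond (F.P P.K) 0 → lieSU (Fin 2), ∑ b, ‖(Y b : Matrix (Fin 2) (Fin 2) ℂ)‖ ^ 2 ≤ p Y ^ 2) ∧
          ∀ X : GaugeSlice (pts (k P i) Λ) T E3,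
            lam (Ψ₂ (fderiv ℝ Xf 0 X) (fderiv ℝ Xf 0 X))
                ≤ (2 * (((F.P P.K).d : ℝ) - 1) * εP * B₁ * M₂) * p (fderiv ℝ Xf 0 X) ^ 2 ∧
            p (fderiv ℝ Xf 0 X) ≤ K₂ * ‖X‖ ∧
            (((F.P P.K).L : ℝ) ^ (F.P P.K).d) ^ (k P i) / ((((F.P P.K).L : ℝ)) ^ 2 * ((F.P P.K).L : ℝ) ^ 2) ^ (k P i) / 2 * (∑ z ∈ box (fun κ => (hi κ - lo κ + 1).toNat + 3) (fun κ => lo κ - 2), ∑ μ : Fin (F.P P.K).d, ∑ a : Fin 3, curl (fun b => ιA (pts (k P i) Λ) T X (⟨castSite b.1, b.2⟩ : PBond (F.P P.K) (k P i)) a) z ⟨0, h0 P⟩ μ ^ 2)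
                - (((F.P P.K).L : ℝ) ^ (F.P P.K).d) ^ (k P i) / ((((F.P P.K).L : ℝ)) ^ 2 * ((F.P P.K).L : ℝ) ^ 2) ^ (k P i) * (8 * (((F.P P.K).d : ℝ) + 1) * (2 * ((Kτ P i) + 1) * δW) + 8 * ((F.P P.K).d : ℝ) * (((box (fun κ => (hi κ - lo κ + 1).toNat + 3) (fun κ => lo κ - 2)).image (fun z => (castSite z : Site (F.P P.K) (k P i)))).card : ℝ) * ((C P i) * δW * K₂) ^ 2) * ‖X‖ ^ 2
              ≤ ((Fintype.card (Fin 2) : ℝ)⁻¹ • ∑ p ∈ W, (innerSL ℝ (E := lieSU (Fin 2))).bilinearComp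
                (ContinuousLinearMap.proj (R := ℝ) (φ := fun _ : PBond (F.P P.K) 0 => lieSU (Fin 2)) (⟨p.src, p.μ⟩ : PBond (F.P P.K) 0) + ContinuousLinearMap.proj (R := ℝ) (φ := fun _ : PBond (F.P P.K) 0 => lieSU (Fin 2)) (⟨p.src.shift p.μ, p.ν⟩ : PBond (F.P P.K) 0)
                  - ContinuousLinearMap.proj (R := ℝ) (φ := fun _ : PBond (F.P P.K) 0 => lieSU (Fin 2)) (⟨p.src.shift p.ν, p.μ⟩ : PBond (F.P P.K) 0) - ContinuousLinearMap.proj (R := ℝ) (φ := fun _ : PBond (F.P P.K) 0 => lieSU (Fin 2)) (⟨p.src, p.ν⟩ : PBond (F.P P.K) 0) : (PBond (F.P P.K) 0 → lieSU (Fin 2)) →L[ℝ] lieSU (Fin 2))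
                (ContinuousLinearMap.proj (R := ℝ) (φ := fun _ : PBond (F.P P.K) 0 => lieSU (Fin 2)) (⟨p.src, p.μ⟩ : PBond (F.P P.K) 0) + ContinuousLinearMap.proj (R := ℝ) (φ := fun _ : PBond (F.P P.K) 0 => lieSU (Fin 2)) (⟨p.src.shift p.μ, p.ν⟩ : PBond (F.P P.K) 0)
                  - ContinuousLinearMap.proj (R := ℝ) (φ := fun _ : PBond (F.P P.K) 0 => lieSU (Fin 2)) (⟨p.src.shift p.ν, p.μ⟩ : PBond (F.P P.K) 0) - ContinuousLinearMap.proj (R := ℝ) (φ := fun _ : PBond (F.P P.K) 0 => lieSU (Fin 2)) (⟨p.src, p.ν⟩ : PBond (F.P P.K) 0) : (PBond (F.P P.K) 0 → lieSU (Fin 2)) →L[ℝ] lieSU (Fin 2))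
                : (PBond (F.P P.K) 0 → lieSU (Fin 2)) →L[ℝ] (PBond (F.P P.K) 0 → lieSU (Fin 2)) →L[ℝ] ℝ) (fderiv ℝ Xf 0 X) (fderiv ℝ Xf 0 X))
    -- the `hsb`-free letter's numeric premises displayed: radius row, the class threshold positive, and its floor against `ρ5` AT THE DATUM SCALE `2·B₃·(cE P+1)·eR P i` (lane ruling (B) «(8)-FLOOR»)
    -- [15]'s comparability rows DOUBLED per instance (base budget `(cE+1)·eR` + the class-reading tolerance `ν″.εreg := 2·B₃·(cE P+1)·eR P i` below the class of record)
    {cE cA : B12.RunParams → ℝ} (hcE0 : ∀ P : B12.RunParams, 0 ≤ cE P) (hcE : ∀ (P : B12.RunParams) (i : ι P), 12 * ((F.P P.K).d : ℝ) * ((n P i : ℝ) + 2) ^ 2 ≤ cE P)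
    (heRa : ∀ (P : B12.RunParams) (i : ι P), (cE P + 1) * (2 * eR P i) ≤ a₁' ∧ B₃ * ((cE P + 1) * (2 * eR P i)) ≤ Θ.ν.εreg)
    (hM4 : ∀ P : B12.RunParams, 4 * (F.P P.K).L ≤ Θ.ν.M₁) (hερ : ∀ (P : B12.RunParams) (i : ι P), 6 * ((((F.P P.K).d - 1 : ℕ)) : ℝ) * (F.P P.K).L * (2 * B₃ * (cE P + 1) * eR P i) ≤ ρ5 P i)
    -- THE (P4)′ PRODUCER's TWO CONSTANTS, THE (P5) CONSTANT AND THE NEAR-FLAT GUARD RADIUS PER INSTANCE, AS BINDERS (`εH`, `ρ6`, `M₂` per height; `B₁` per `(M₁, Z)` — never after `εreg`∕`ρn`),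
    -- and THREE LETTERS displayed: `hHrow` = dag-n12-w6 g7's `N12DirectSurjHsurjProxiesLam.exists_rightInverse_letter_of_proxies` (p678596) premises at `(2, Kt, k i, ν.M₁, Z i; εH i)` VERBATIM —
    -- NO `SmallBelow U₀`: its guarded PROXIES (per constrained bond, per inner site) are produced from the class below — concluding, in ρ6b's PER-ROW ℓ¹ CURRENCY, a right inverse `H`
    -- (surjectivity witness) AND the per-row ℓ¹ preimage letter at `B₁ i`; `hsbU` ∕ `hcurv` = the two conjuncts of dag-n12-w4's `Node00.exists_uniform_chartCurvature_sq_bound (k i)` at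
    -- `(ρ6 i, M₂ i)` (near-flat fields are guarded; uniform sup-curvature bound at the near-flat core) — ρ7 turns them into the ℓ¹-curvature bound with the local count `Σ_{j≤k i}(2d)^j`
    (εH B₁ M₂ ρ6 : ∀ P : B12.RunParams, ι P → ℝ) (hB1 : ∀ (P : B12.RunParams) (i : ι P), 0 ≤ B₁ P i) (hM₂0 : ∀ (P : B12.RunParams) (i : ι P), 0 ≤ M₂ P i)
    (hHrow : ∀ (P : B12.RunParams) (i : ι P) (Wd : MSField (F.P P.K) SU2) (U₀ : GaugeField (F.P P.K) 0 SU2),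
      AgreeOn (Bj Θ.ν.M₁ (Z P i) (k P i)) (avgFamily (Node00.avOfRecord F 2 P.K) U₀) Wd →
      (∀ i' : Fin (constrCard (Bj Θ.ν.M₁ (Z P i) (k P i)) (k P i)), ∃ U' : GaugeField (F.P P.K) 0 SU2,
        (∀ b ∈ feeds (((constrEnum (Bj Θ.ν.M₁ (Z P i) (k P i)) (k P i)).symm i').1 : ℕ) ((constrEnum (Bj Θ.ν.M₁ (Z P i) (k P i)) (k P i)).symm i').2.1, U' b = U₀ b) ∧
          Node00.SmallBelow (Node00.avOfRecord F 2 P.K) (k P i) U') →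
      (∀ (j : ℕ), 1 ≤ j → j ≤ k P i → ∀ y : Site (F.P P.K) j, embIter j y ∈ maxDomT Θ.ν.M₁ (Z P i) j → ∃ U' : GaugeField (F.P P.K) 0 SU2,
        (∀ c : PBond (F.P P.K) j, (c.src = y ∨ c.tgt = y) → ∀ b₀ : PBond (F.P P.K) 0,
          (iterBlockOf j b₀.src = c.src ∨ iterBlockOf j b₀.src = c.tgt) → (iterBlockOf j b₀.tgt = c.src ∨ iterBlockOf j b₀.tgt = c.tgt) → U' b₀ = U₀ b₀) ∧
        Node00.SmallBelow (Node00.avOfRecord F 2 P.K) (k P i) U') →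
      (∀ (j : ℕ), 1 ≤ j → j ≤ k P i → ∀ y : Site (F.P P.K) j, embIter j y ∈ maxDomT Θ.ν.M₁ (Z P i) j →
        PlaqSmallOn (boxPlaqs (fun κ => lift (F.P P.K) (embIter j y) κ - ((((F.P P.K).L ^ j : ℕ) : ℤ) + ((((F.P P.K).L ^ j - 1) / 2 : ℕ) : ℤ)))
          (fun κ => lift (F.P P.K) (embIter j y) κ + ((((F.P P.K).L ^ j : ℕ) : ℤ) + ((((F.P P.K).L ^ j - 1) / 2 : ℕ) : ℤ))) : Set (Plaq (F.P P.K) 0)) (εH P i) U₀) →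
      ∃ H : (Fin (constrCardB (lamBondsSeq (maxDomT Θ.ν.M₁ (Z P i)) (k P i)) (k P i)) → lieSU (Fin 2)) → PBond (F.P P.K) 0 → lieSU (Fin 2),
        (∀ v, fderiv ℝ (msChartB F 2 P.K (k P i) (lamBondsSeq (maxDomT Θ.ν.M₁ (Z P i)) (k P i)) Wd U₀) 0 (H v) = v) ∧
        ∀ i' : Fin (constrCardB (lamBondsSeq (maxDomT Θ.ν.M₁ (Z P i)) (k P i)) (k P i)), 1 ≤ ((((constrEnumB (lamBondsSeq (maxDomT Θ.ν.M₁ (Z P i)) (k P i)) (k P i)).symm i').1 : ℕ)) → ∀ ξ : lieSU (Fin 2),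
          ∃ x : PBond (F.P P.K) 0 → lieSU (Fin 2), fderiv ℝ (msChartB F 2 P.K (k P i) (lamBondsSeq (maxDomT Θ.ν.M₁ (Z P i)) (k P i)) Wd U₀) 0 x = Pi.single i' ξ ∧
            ∑ b, ‖(x b : Matrix (Fin 2) (Fin 2) ℂ)‖ ≤ B₁ P i * ‖ξ‖)
    (hsbU : ∀ (P : B12.RunParams) (i : ι P) (V : GaugeField (F.P P.K) 0 SU2), ‖coeField V - 1‖ ≤ ρ6 P i → Node00.SmallBelow (Node00.avOfRecord F 2 P.K) (k P i) V)
    (hcurv : ∀ (P : B12.RunParams) (i : ι P) (𝔅 : BDetSet (F.P P.K)) (Wd : MSField (F.P P.K) SU2) (V : GaugeField (F.P P.K) 0 SU2),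
      ‖coeField V - 1‖ ≤ ρ6 P i → AgreeOnB 𝔅 (avgFamily (Node00.avOfRecord F 2 P.K) V) Wd →
      ∀ w : PBond (F.P P.K) 0 → lieSU (Fin 2), ‖fderiv ℝ (fderiv ℝ (msChartB F 2 P.K (k P i) 𝔅 Wd V)) 0 w w‖ ≤ M₂ P i * ‖w‖ ^ 2)
    -- the near-flat radius's floor AT THE DATUM SCALE (volume-free; lane ruling (B))
    (hερ6 : ∀ (P : B12.RunParams) (i : ι P), 6 * ((((F.P P.K).d - 1 : ℕ)) : ℝ) * (F.P P.K).L * (2 * B₃ * (cE P + 1) * eR P i) ≤ ρ6 P i)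
    -- THE TWO CLASS-CONVERSION LETTERS of the datum-scale road («INHABITED BY»: dag-n12-c g31's kit `B15Prop1MinimiserClassAtDatumScale` — [15] (8) via `h15` + the datum's (7)):
    -- (K-a) base datum, (K-b) slice-perturbed datum near `0` — class of record ⟹ class at `ν″ := {Θ.ν with εreg := 2·B₃·(cE P+1)·eR P i}`
    (hKa : ∀ (P : B12.RunParams) (i : ι P) (Vk : GaugeField (F.P P.K) (k P i) SU2), PlaqSmallOn (plaqsInside (pts (k P i) (Z P i ∩ (Λ P i)ᶜ))) (eR P i) Vk →
      (∀ b ∈ (boxBonds (LO P i) (HI P i) : Set (PBond (F.P P.K) (k P i))), dist1 (ext P i Vk b) ≤ ρn P i) →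
      ∀ U₀ : GaugeField (F.P P.K) 0 SU2,
        IsMinimizerB (Node00.avOfRecord F 2 P.K) (Node00.regMSCoPOfRecord F 2 Θ.ν P.K (k P i) (maxDomT Θ.ν.M₁ (Z P i))) (lamBondsSeq (maxDomT Θ.ν.M₁ (Z P i)) (k P i))
          (avgFamily (Node00.avOfRecord F 2 P.K) (qsstarGIter0 (k P i) (ext P i Vk))) U₀ →
        IsMinimizerB (Node00.avOfRecord F 2 P.K) (Node00.regMSCoPOfRecord F 2 {Θ.ν with εreg := 2 * B₃ * (cE P + 1) * eR P i} P.K (k P i) (maxDomT Θ.ν.M₁ (Z P i))) (lamBondsSeq (maxDomT Θ.ν.M₁ (Z P i)) (k P i))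
          (avgFamily (Node00.avOfRecord F 2 P.K) (qsstarGIter0 (k P i) (ext P i Vk))) U₀)
    (hKb : ∀ (P : B12.RunParams) (i : ι P) (Vk : GaugeField (F.P P.K) (k P i) SU2), PlaqSmallOn (plaqsInside (pts (k P i) (Z P i ∩ (Λ P i)ᶜ))) (eR P i) Vk →
      (∀ b ∈ (boxBonds (LO P i) (HI P i) : Set (PBond (F.P P.K) (k P i))), dist1 (ext P i Vk b) ≤ ρn P i) →
      ∃ r : ℝ, 0 < r ∧ ∀ Y : GaugeSlice (pts (k P i) (Λ P i)) (T P i) E3, ‖Y‖ < r → ∀ U : GaugeField (F.P P.K) 0 SU2,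
        IsMinimizerB (Node00.avOfRecord F 2 P.K) (Node00.regMSCoPOfRecord F 2 Θ.ν P.K (k P i) (maxDomT Θ.ν.M₁ (Z P i))) (lamBondsSeq (maxDomT Θ.ν.M₁ (Z P i)) (k P i))
          (avgFamily (Node00.avOfRecord F 2 P.K) (qsstarGIter0 (k P i) (expMul su2Chart (ιA (pts (k P i) (Λ P i)) (T P i) Y) (ext P i Vk)))) U →
        IsMinimizerB (Node00.avOfRecord F 2 P.K) (Node00.regMSCoPOfRecord F 2 {Θ.ν with εreg := 2 * B₃ * (cE P + 1) * eR P i} P.K (k P i) (maxDomT Θ.ν.M₁ (Z P i))) (lamBondsSeq (maxDomT Θ.ν.M₁ (Z P i)) (k P i))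
          (avgFamily (Node00.avOfRecord F 2 P.K) (qsstarGIter0 (k P i) (expMul su2Chart (ιA (pts (k P i) (Λ P i)) (T P i) Y) (ext P i Vk)))) U)
    -- NO letter per guarded base field ∕ minimiser remains here: the (P4)′ socket and the (P5) row are DISCHARGED below from the class through `hHrow` ∕ `hsbU` ∕ `hcurv` (+ ρ7's local count)
    -- numerics: the positivity constant fits (`γ₀ := 1∕2`: the chart half's level factor `((L^d)^k∕(L²·L²)^k)∕2` at `d = 4`)
    (hγle : ∀ (P : B12.RunParams) (i : ι P), γ₈ P / (M P i) ^ 5 ≤ 1 / 2 / (2 * (3 * (Kb P i : ℝ) ^ 2 + 2 * (Kb P i : ℝ) ^ 4)))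
    -- the geometric letter: every fine site whose k-block label lies in the box `[lo − 1, hi + 1]` lies in `Ω₁(Z)` (print: `Λ` deep inside `Z`); dag-n12-c's `far_letter_of_box` turns it into the bond letter `hfar`
    (hZ1 : ∀ (P : B12.RunParams) (i : ι P) (y : Site (F.P P.K) 0), B14.Eq22Determines.blockIter (k P i) y ∈ (castSite '' Set.Icc (lo P i - 1) (hi P i + 1) : Set (Site (F.P P.K) (k P i))) → y ∈ maxDomT Θ.ν.M₁ (Z P i) 1)
    (hZblk : ∀ (P : B12.RunParams) (i : ι P), IsBlockUnion (k P i) (Z P i))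
    (hdiv : ∀ (P : B12.RunParams) (i : ι P), side (F.P P.K).L Θ.ν.M₁ (k P i) ∣ (F.P P.K).sitesPerDir 0)
    (hcA : ∀ (P : B12.RunParams) (i : ι P), 1 / 2 * (B₃ * (cE P + 1) * (F.P P.K).eta 1 ^ 2) ^ 2 * (Nat.card {q : Plaq (F.P P.K) 0 // q ∈ plaqsOf (maxDomT Θ.ν.M₁ (Z P i) 1)} : ℝ) ≤ cA P)
    (hcJ' : ∀ (P : B12.RunParams) (i : ι P), 2 * cA P * eR P i / R P i + 2 * ((Nat.card {q : Plaq (F.P P.K) 0 // q ∈ plaqsOf (maxDomT Θ.ν.M₁ (Z P i) 1)} : ℝ) * (1 + 8 * 𝓐₀ P i ^ 4)) / (R P i * eR P i) ≤ cJ P)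
    -- THE EXPLICIT-THRESHOLD FRAME (no `∃ δ₀`): tolerances below `Θ i := min (min (ρ i) (ρτ i) ∕ 2) (min 1 (rhs_i ∕ (max S_i 0 + 1)))`, every symbol a binder or a cardinality
    (hM2 : 2 ≤ Θ.ν.M₁) (hB₃ : 0 < B₃) (hεreg : 0 < Θ.ν.εreg) (ha₀ : Θ.ν.εreg ≤ a₀)
    -- [15] THEOREM 1 (R) = (8) OVER NODE 00's TORUS CLASS, READ AT EACH INSTANCE's OWN LENGTH `k P i` ON THE RUN's LATTICE (α's letter text; ANONYMOUS — no [15] token named; served from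
    -- K0⁷'s guarded token by β `thm1LetterT_atLength_of_variationalThm1RegSepCoP7MG_grid` at the junction, or from the floor-free name by `thm1TorusClass_of_variationalThm1RegSepCoP7M`)
    (h15T : ∀ (P : B12.RunParams) (i : ι P) (s : B14.Eq218Concrete.Seq (fun n : ℕ => Node00.unionsOfCubes (F.P P.K) (side (F.P P.K).L Θ.ν.M₁ n)) (k P i)),
      Node00.Sect2.SeqSeparated Θ.ν.M₁ s → 0 < Θ.ν.M₁ →
      ∀ (ε₀ : ℝ) (δ : ℕ → ℝ), (∀ j, j ≤ k P i → 0 < δ j ∧ δ j ≤ a₁' ∧ B₃ * δ j ≤ ε₀) → (∀ j, j < k P i → δ j ≤ 2 * δ (j + 1)) →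
      (∀ j, j < k P i → δ (j + 1) ≤ 2 * δ j) → ε₀ ≤ a₀ →
      ∀ W : MSField (F.P P.K) SU2,
        Node00.Sect2.DataSmall7PTop (Node00.avOfRecord F 2 P.K) s.Ω (Node00.suppDomOfRecord F Θ.ν P.K s.Ω) (k P i) δ W →
        ∀ U₀ : GaugeField (F.P P.K) 0 SU2, IsMinimizerB (Node00.avOfRecord F 2 P.K)
            {U | (∀ j, j ≤ k P i → PlaqSmallOn (Node00.Sect2.omegaPlaqsTop s.Ω (Node00.suppDomOfRecord F Θ.ν P.K s.Ω) j)
                (ε₀ * (F.P P.K).eta j ^ 2) U) ∧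
              Node00.Sect2.CoDivClassOnTop s.Ω (Node00.suppDomOfRecord F Θ.ν P.K s.Ω) (k P i) ε₀ U}
            (lamBondsSeq s.Ω (k P i)) W U₀ →
          (∀ j, j ≤ k P i → PlaqSmallOn (Node00.Sect2.omegaPlaqsTop s.Ω (Node00.suppDomOfRecord F Θ.ν P.K s.Ω) j)
              (B₃ * δ j * (F.P P.K).eta j ^ 2) U₀) ∧
            ∀ j, j ≤ k P i → Node00.Sect2.CoDivSmallOn (Node00.Sect2.omegaBondsTop s.Ω (Node00.suppDomOfRecord F Θ.ν P.K s.Ω) j)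
              (B₃ * δ j * (F.P P.K).eta j ^ 3) U₀) :
    ∀ δ : ∀ P : B12.RunParams, ι P → ℝ, (∀ P i, 0 < δ P i) →
      -- the endpoint's EXPLICIT THRESHOLD per run (every quantity a displayed binder or a count of the run's instance — no `∃ δ₀`), then its TOLERANCE rows at `δ P i`
      (∀ (P : B12.RunParams) (i : ι P), δ P i ≤ min (min (min (ρ P i) (ρτ P i) / 2)
        (min 1 (1 / 2 / (2 * (3 * (Kb P i : ℝ) ^ 2 + 2 * (Kb P i : ℝ) ^ 4)) /
          (max ((32 * (((F.P P.K).d : ℝ) - 1) + 8 * (((F.P P.K).d : ℝ) - 1) + (2 * (((F.P P.K).d : ℝ) - 1) * B₁ P i * (((∑ j ∈ Finset.range (k P i + 1), (2 * (F.P P.K).d) ^ j : ℕ) : ℝ) * M₂ P i))) * (12 * 𝓐₀ P i / R P i * Real.sqrt (Nat.card {b : PBond (F.P P.K) 0 // b ∈ {b : PBond (F.P P.K) 0 | b.src ∈ maxDomT Θ.ν.M₁ (Z P i) 1 ∨ b.tgt ∈ maxDomT Θ.ν.M₁ (Z P i) 1}})) ^ 2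
            + (8 * (((F.P P.K).d : ℝ) + 1) * (2 * (Kτ P i + 1)) + 8 * ((F.P P.K).d : ℝ) * (((box (fun κ => (hi P i κ - lo P i κ + 1).toNat + 3) (fun κ => lo P i κ - 2)).image (fun z => (castSite z : Site (F.P P.K) (k P i)))).card : ℝ) * (C P i * (12 * 𝓐₀ P i / R P i * Real.sqrt (Nat.card {b : PBond (F.P P.K) 0 // b ∈ {b : PBond (F.P P.K) 0 | b.src ∈ maxDomT Θ.ν.M₁ (Z P i) 1 ∨ b.tgt ∈ maxDomT Θ.ν.M₁ (Z P i) 1}}))) ^ 2)) 0 + 1)))) (εH P i)) →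
      ∀ (hfloor : ∀ (P : B12.RunParams) (i : ι P), ((((4 * (F.P P.K).d + (3 * ((F.P P.K).d * (((F.P P.K).L - 1) / 2)) + 5) + 3 : ℕ) : ℝ)) ^ 2 * ((F.P P.K).L : ℝ) ^ 2 / 4 + ((3 * ((F.P P.K).d * (((F.P P.K).L - 1) / 2)) + 5 : ℕ) : ℝ) * (24 * (((((F.P P.K).d + 2) * (F.P P.K).L : ℕ) : ℝ) ^ 2 / 4))) * (2 * B₃ * (cE P + 1) * eR P i) + ((3 * ((F.P P.K).d * (((F.P P.K).L - 1) / 2)) + 5 : ℕ) : ℝ) * ρn P i ≤ δ P i),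
      ∃ areg : ∀ P : B12.RunParams, ι P → ℝ, (∀ P i, 0 < areg P i) ∧
        ∀ P : B12.RunParams, lam.kSel P < P.K → Step.InInterval γβ P.K (gOfRecord₁₃Chi F 2 (Θ.liveRepin₁₃Chi F 2 χ) χ P) →
          B15Leaf (WOfRecord₁₃Chi F 2 (Θ.liveRepin₁₃Chi F 2 χ) χ
            ((ResidW.pinRPrime₁₃Chi { lam with LF := fun P => lfVarOn su2Chart fun i => InstOn.stdB (Node00.bgMSCoPOfRecordB F 2 Θ.ν P.K (k P i) (maxDomT Θ.ν.M₁ (Z P i))) Θ.ν.M₁ lamDatumP (Z P i) (Λ P i) (k P i) (M P i) (areg P i) (anExt (pts (k P i) (Λ P i)) (T P i) (fun177stdB (Node00.bgMSCoPOfRecordB F 2 Θ.ν P.K (k P i) (maxDomT Θ.ν.M₁ (Z P i))) Θ.ν.M₁ lamDatumP (Z P i) (k P i)) (ext P i) (min (1 / 2) (min (R P i / 8) (γ₈ P / (M P i) ^ 5 * (R P i / 2) ^ 2 / (48 * (4 * ((Nat.card {q : Plaq (F.P P.K) 0 // q ∈ plaqsOf (maxDomT Θ.ν.M₁ (Z P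 i) 1)} : ℝ) * (1 + 8 * 𝓐₀ P i ^ 4)) / R P i + 1)))))) } (Θ.liveRepin₁₃Chi F 2 χ) χ).pinD189ΛH (Θ.liveRepin₁₃Chi F 2 χ).ν (Θ.liveRepin₁₃Chi F 2 χ).A₁ (Θ.liveRepin₁₃Chi F 2 χ).τ9.M (gOfRecord₁₃Chi F 2 (Θ.liveRepin₁₃Chi F 2 χ) χ) (fun P => (((((σ P).pinZres Θ.ν Θ.τ9.M (gOfRecord₁₃Chi F 2 (Θ.liveRepin₁₃Chi F 2 χ) χ P) (sq P) (N0OfRecord₁₃Chi (Θ.liveRepin₁₃Chi F 2 χ) χ P (lam.kSel P + 1))).pinSides Θ.ν (gOfRecord₁₃Chi F 2 (Θ.liveRepin₁₃Chi F 2 χ) χ P) (lam.kSel P + 1 - Nm P) (lam.kSel P + 1)).pinXΩ4 (sq P) (enlD F Θ.ν Θ.τ9.M P (gOfRecord₁₃Chi F 2 (Θ.liveRepin₁₃Chi F 2 χ) χ P))).pinOmegaPP (sq P) (Nm P) (enlD F Θ.ν Θ.τ9.M P (gOfRecord₁₃Chi F 2 (Θ.liveRepin₁₃Chi F 2 χ)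 χ P)))) sq Nm p₁) P) := by
  intro δtol hδtol hδtol_le hfloor
  choose areg hapos hrow using fun P : B12.RunParams =>
    exists_domain_prop1Printed_lfVarOn_std_su2_box_intrinsic_analytic_atZSeqCoPRecord_ofThm1AtLength_ofMinimiserFamily_ofClassOnlyRowL1NearRadiusDatumScale_ofWindowGaugeUniform_explicit (F := F) Θ.ν P.K (hd3 P) (h0 P)
      (Z := Z P) (Λ := Λ P) (k := k P) (M := M P) (hk0 := hk0 P) (hk1 := hk1 P) (eR := eR P) (heR := heR P) (T := T P) (lo := lo P) (hi := hi P) (n := n P) (hn := hn P)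
      (hN := hN P) (hbox := hbox P) (hZ := hZ P) (hTG0 := hTG0 P) (hN5 := hN5 P) (K := Kb P) (hK1 := hK1 P) (hKn := hKn P) (ext := ext P) (hext := hext P) (hlohi := hlohi P)
      (LO := LO P) (HI := HI P) (hLO := hLO P) (hHI := hHI P) (n' := n' P) (hn' := hn' P) (hn'N := hn'N P) (hR' := hR' P) (ρn := ρn P) (hρn := hρn P) (hγ := hγ P)
      (hcJ := hcJ P) (hbx := hbx P) (hbxM := hbxM P) (hM := hM P) (hR := hR P) (h𝓐₀ := h𝓐₀ P) (hMin := hMin P) (hΩw := hΩw P) (W := W P) (hWbox := hWbox P) (c := c P)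
      (hkc := hkc P) (hc := hc P) (hα3 := hα3 P) (hα2 := hα2 P) (haN := haN P) (X := X P) (D₀ := D₀ P) (hXΩ := hXΩ P) (hfit := hfit P) (hBox := hBox P) (hWX := hWX P)
      (hfeedsX := hfeedsX P) (C := C P) (ρ := ρ P) (Kτ := Kτ P) (ρτ := ρτ P) (ρ5 := ρ5 P) (hρ := hρ P) (hKτ := hKτ P) (hρτ := hρτ P) (hhalf := hhalf P) (hM4 := hM4 P)
      (hεreg := hεreg) (hερ := hερ P) (εH := εH P) (B₁ := B₁ P) (M₂ := M₂ P) (ρ6 := ρ6 P) (hB1 := hB1 P) (hM₂0 := hM₂0 P) (hHrow := hHrow P) (hsbU := hsbU P)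
      (hcurv := hcurv P) (hερ6 := hερ6 P) (hKa := hKa P) (hKb := hKb P) (hγle := hγle P) (hfar := fun i b hb => far_letter_of_box (hbox P i) (hZ1 P i) b hb) (hZblk := hZblk P) (hM2 := hM2)
      (hdiv := hdiv P) (hcE0 := hcE0 P) (hcE := hcE P) (hB₃ := hB₃) (heRa := heRa P) (ha₀ := ha₀) (hcA := hcA P) (h15T := h15T P)
      (hcJ' := hcJ' P)
      (δtol P) (hδtol P) (hδtol_le P) (hfloor P)
  refine ⟨areg, hapos, fun P hkP hIP => ?_⟩
  -- THE TERM-PINNED LEAF (12P ✓p516715 §1) at the LF-pinned layer, in place of the parent's `b15Leaf_WOfRecord₁₃_liveRepin₁₃_of_massLive_of_hasResiduals` with its three free rows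
  exact b15Leaf_WOfRecord₁₃_pinAllΛΩχZ_N0_liveRepin₁₃_of_massLive_of_hasResiduals_of_flow_of_betaLowerH Θ χ { lam with LF := fun P => lfVarOn su2Chart fun i => InstOn.stdB (Node00.bgMSCoPOfRecordB F 2 Θ.ν P.K (k P i) (maxDomT Θ.ν.M₁ (Z P i))) Θ.ν.M₁ lamDatumP (Z P i) (Λ P i) (k P i) (M P i) (areg P i) (anExt (pts (k P i) (Λ P i)) (T P i) (fun177stdB (Node00.bgMSCoPOfRecordB F 2 Θ.ν P.K (k P i) (maxDomT Θ.ν.M₁ (Z P i))) Θ.ν.M₁ lamDatumP (Z P i) (k P i)) (ext P i) (min (1 / 2) (min (R P i / 8) (γ₈ P / (M P i) ^ 5 * (R P i / 2) ^ 2 / (48 * (4 * ((Nat.card {q : Plaq (F.P P.K) 0 // q ∈ plaqsOf (maxDomT Θ.ν.M₁ (Z P i) 1)} : ℝ) * (1 + 8 * 𝓐₀ P i ^ 4)) / R P i + 1)))))) } σ sq Nm p₁ hres hkP tM₂ tMτ (hDst P) (hmassLive P hkP) (hrow P)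
    (tlog P hkP) (tNN P hkP) (tNk P hkP) (tβ0 P hkP) (tβ P hkP) (tL₀ P hkP) (tL₀L P hkP) (tB P hkP) (tδ P hkP) (tN₀ P hkP) (tMl P hkP) (tε0 P hkP) (tε1 P hkP)
    tβ₀0 tβ₀ (tflow P hkP) tb tlow tγ1 hIP (tΛ P hkP) (L91h P hkP) (L95 P hkP) (L91 P hkP) (L97 P hkP) (L80 P hkP)

end

end Summit.QuantumFields.YangMills.BalabanUVNodes.N12AtRecord13Prop1KnitThm1WindowLocalOfClassOnlyRowL1NearRadiusDatumScaleAtLengthOfRecordBTermPinnedChi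

end
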